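import Mathlib.Analysis.SpecialFunctions.SmoothTransition
import Mathlib.Analysis.SpecialFunctions.ExpDeriv
import Literature.Analysis.Calculus.SmoothCutoff
import HarnessLib

/-!
# K1loc, line `Spectral` / SeqCone — helper: A NUMERICAL BOUND FOR THE SLOPE OF MATHLIB'S SMOOTH STEP (S-B constants, (g3))

Helper file of the prover lane on the crux `K1LocalisedCascade` (stmt-AnomalousDissipation-19491), route
`SawtoothPulseCascade` (glue seat k1loc-p3).  Every constant of the S-B assembly is explicit in bounds `C₁ ≥ sup|sT′|`,
`C₂ ≥ sup|sT″|` of Mathlib's `Real.smoothTransition` (`…SocketConstantsExplicit`, `…ConcreteStepHMoments`); the tree only had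
their existence.  Here: on `(0,1)` the smooth step is `S(y) = f/(f+h)` with `f = e^{−1/y}`, `h = e^{−1/(1−y)}`, so
`S′ = fh(y⁻² + (1−y)⁻²)/(f+h)²`; with `u²e^{−u} ≤ 4e^{−2}` (`sq_mul_exp_neg_le`) and `f + h ≥ e^{−2}` this gives
**`|sT′| ≤ 8`** everywhere (`abs_deriv_smoothTransition_le_eight`; the true maximum is `2`).  No definitions.
[cite: Grafakos2014, Prop. 3.1.2 (5)] [problem: turb]
-/

-- `Summit.<Summit>.<Problem>`: single-conjunct summit, the duplicate namespace segment is deliberate.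
set_option linter.dupNamespace false

noncomputable section

namespace Summit.AnomalousDissipation.AnomalousDissipation.Theorems.SawtoothPulseCascade.K1Cutoff

open Set Filter Topology
open Literature.Analysis.Calculus

/-- `u²e^{−u} ≤ 4e^{−2}` for `u ≥ 0` (from `1 + t ≤ eᵗ` at `t = u/2 − 1`). [folklore] -/
theorem sq_mul_exp_neg_le {u : ℝ} (hu : 0 ≤ u) : u ^ 2 * Real.exp (-u) ≤ 4 * Real.exp (-2) := by
  have h := Real.add_one_le_exp (u / 2 - 1)
  have h1 : u / 2 ≤ Real.exp (u / 2 - 1) := by linarith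
  have h2 : (u / 2) ^ 2 ≤ Real.exp (u / 2 - 1) ^ 2 := pow_le_pow_left₀ (by positivity) h1 2
  have h3 : Real.exp (u / 2 - 1) ^ 2 = Real.exp (u - 2) := by
    rw [← Real.exp_nat_mul]; congr 1; push_cast; ring
  rw [h3] at h2
  calc u ^ 2 * Real.exp (-u) = 4 * (u / 2) ^ 2 * Real.exp (-u) := by ring
    _ ≤ 4 * Real.exp (u - 2) * Real.exp (-u) := by gcongr
    _ = 4 * Real.exp (-2) := by rw [mul_assoc, ← Real.exp_add]; ring_nf

/-- `e^{−1/y}·y⁻² ≤ 4e^{−2}` for `y > 0`. [folklore] -/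
theorem exp_neg_inv_mul_inv_sq_le {y : ℝ} (hy : 0 < y) : Real.exp (-y⁻¹) * (y ^ 2)⁻¹ ≤ 4 * Real.exp (-2) := by
  have h := sq_mul_exp_neg_le (inv_nonneg.mpr hy.le)
  rwa [inv_pow, mul_comm] at h

/-- On `(0,1)` the smooth step is the explicit quotient `e^{−1/y}/(e^{−1/y} + e^{−1/(1−y)})`. [folklore] -/
theorem smoothTransition_eventuallyEq_of_mem_Ioo {x : ℝ} (hx : x ∈ Ioo (0 : ℝ) 1) :
    Real.smoothTransition =ᶠ[𝓝 x] fun y => Real.exp (-y⁻¹) / (Real.exp (-y⁻¹) + Real.exp (-(1 - y)⁻¹)) := by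
  filter_upwards [Ioo_mem_nhds hx.1 hx.2] with y hy
  have h1 : expNegInvGlue y = Real.exp (-y⁻¹) := by simp [expNegInvGlue, not_le.mpr hy.1]
  have h2 : expNegInvGlue (1 - y) = Real.exp (-(1 - y)⁻¹) := by
    simp [expNegInvGlue, not_le.mpr (by linarith [hy.2] : (0 : ℝ) < 1 - y)]
  simp only [Real.smoothTransition, h1, h2]

/-- The derivative of the explicit quotient on `(0,1)`. [folklore] -/
theorem hasDerivAt_smoothTransition_model {x : ℝ} (hx : x ∈ Ioo (0 : ℝ) 1) :
    HasDerivAt (fun y => Real.exp (-y⁻¹) / (Real.exp (-y⁻¹) + Real.exp (-(1 - y)⁻¹)))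
      (Real.exp (-x⁻¹) * Real.exp (-(1 - x)⁻¹) * ((x ^ 2)⁻¹ + ((1 - x) ^ 2)⁻¹) /
        (Real.exp (-x⁻¹) + Real.exp (-(1 - x)⁻¹)) ^ 2) x := by
  have hx0 : x ≠ 0 := hx.1.ne'
  have hx1 : 1 - x ≠ 0 := sub_ne_zero.mpr hx.2.ne'
  have hf : HasDerivAt (fun y => Real.exp (-y⁻¹)) (Real.exp (-x⁻¹) * (x ^ 2)⁻¹) x := by
    have h := ((hasDerivAt_inv hx0).neg).exp
    simpa using h
  have hi : HasDerivAt (fun y => (1 - y)⁻¹) (-((1 - x) ^ 2)⁻¹ * (0 - 1)) x :=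
    (hasDerivAt_inv hx1).comp x ((hasDerivAt_const x (1 : ℝ)).sub (hasDerivAt_id x))
  have hg : HasDerivAt (fun y => Real.exp (-(1 - y)⁻¹)) (Real.exp (-(1 - x)⁻¹) * (-(-((1 - x) ^ 2)⁻¹ * (0 - 1)))) x :=
    hi.neg.exp
  have hD : Real.exp (-x⁻¹) + Real.exp (-(1 - x)⁻¹) ≠ 0 := by positivity
  have hden : HasDerivAt (fun y => Real.exp (-y⁻¹) + Real.exp (-(1 - y)⁻¹))
      (Real.exp (-x⁻¹) * (x ^ 2)⁻¹ + Real.exp (-(1 - x)⁻¹) * -(-((1 - x) ^ 2)⁻¹ * (0 - 1))) x := hf.add hg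
  exact (hf.div hden hD).congr_deriv (by ring)

/-- **The slope bound on `(0,1)`**: `0 ≤ S′(x) ≤ 8`. [folklore] -/
theorem smoothTransition_model_deriv_le {x : ℝ} (hx : x ∈ Ioo (0 : ℝ) 1) :
    Real.exp (-x⁻¹) * Real.exp (-(1 - x)⁻¹) * ((x ^ 2)⁻¹ + ((1 - x) ^ 2)⁻¹) /
        (Real.exp (-x⁻¹) + Real.exp (-(1 - x)⁻¹)) ^ 2 ≤ 8 := by
  set f := Real.exp (-x⁻¹) with hf
  set h := Real.exp (-(1 - x)⁻¹) with hh
  have hf0 : 0 < f := Real.exp_pos _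
  have hh0 : 0 < h := Real.exp_pos _
  have hD : 0 < f + h := by positivity
  have h1x : 0 < 1 - x := by linarith [hx.2]
  -- the two numerators
  have hA : f * (x ^ 2)⁻¹ ≤ 4 * Real.exp (-2) := exp_neg_inv_mul_inv_sq_le hx.1
  have hB : h * ((1 - x) ^ 2)⁻¹ ≤ 4 * Real.exp (-2) := exp_neg_inv_mul_inv_sq_le h1x
  -- the denominator: `f + h ≥ e^{−2}`
  have hDen : Real.exp (-2) ≤ f + h := by
    rcases le_or_gt (1 / 2) x with hle | hlt
    · have : Real.exp (-2) ≤ f := by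
        rw [hf]; apply Real.exp_le_exp.mpr
        have : x⁻¹ ≤ 2 := by rw [inv_le_comm₀ hx.1 two_pos]; linarith
        linarith
      linarith
    · have : Real.exp (-2) ≤ h := by
        rw [hh]; apply Real.exp_le_exp.mpr
        have : (1 - x)⁻¹ ≤ 2 := by rw [inv_le_comm₀ h1x two_pos]; linarith
        linarith
      linarith
  have hinvD : 1 / (f + h) ≤ Real.exp 2 := by
    rw [div_le_iff₀ hD]
    have : Real.exp 2 * Real.exp (-2) = 1 := by rw [← Real.exp_add]; norm_num
    nlinarith [Real.exp_pos 2]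
  -- split the quotient
  have hsplit : f * h * ((x ^ 2)⁻¹ + ((1 - x) ^ 2)⁻¹) / (f + h) ^ 2 =
      (f * (x ^ 2)⁻¹) * (h / (f + h)) * (1 / (f + h)) + (h * ((1 - x) ^ 2)⁻¹) * (f / (f + h)) * (1 / (f + h)) := by
    field_simp
  have hq1 : h / (f + h) ≤ 1 := by rw [div_le_one hD]; linarith
  have hq2 : f / (f + h) ≤ 1 := by rw [div_le_one hD]; linarith
  have he : 4 * Real.exp (-2) * 1 * Real.exp 2 = 4 := by
    rw [mul_one, mul_assoc, ← Real.exp_add]; norm_num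
  rw [hsplit]
  calc (f * (x ^ 2)⁻¹) * (h / (f + h)) * (1 / (f + h)) + (h * ((1 - x) ^ 2)⁻¹) * (f / (f + h)) * (1 / (f + h))
      ≤ 4 * Real.exp (-2) * 1 * Real.exp 2 + 4 * Real.exp (-2) * 1 * Real.exp 2 := by
        gcongr
    _ = 8 := by rw [he]; norm_num

/-- **`|sT′(x)| ≤ 8` for every real `x`** (Mathlib's `Real.smoothTransition`; the true supremum is `2`).
[cite: Grafakos2014, Prop. 3.1.2 (5)] -/
theorem abs_deriv_smoothTransition_le_eight (x : ℝ) : |deriv Real.smoothTransition x| ≤ 8 := by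
  by_cases hx : x ∈ Ioo (0 : ℝ) 1
  · rw [(smoothTransition_eventuallyEq_of_mem_Ioo hx).deriv_eq, (hasDerivAt_smoothTransition_model hx).deriv]
    have hnum : 0 ≤ Real.exp (-x⁻¹) * Real.exp (-(1 - x)⁻¹) * ((x ^ 2)⁻¹ + ((1 - x) ^ 2)⁻¹) /
        (Real.exp (-x⁻¹) + Real.exp (-(1 - x)⁻¹)) ^ 2 := by positivity
    rw [abs_of_nonneg hnum]
    exact smoothTransition_model_deriv_le hx
  · rw [mem_Ioo, not_and_or, not_lt, not_lt] at hx
    rcases hx with hx | hx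
    · rw [deriv_smoothTransition_of_nonpos hx, abs_zero]; norm_num
    · rw [deriv_smoothTransition_of_one_le hx, abs_zero]; norm_num

end Summit.AnomalousDissipation.AnomalousDissipation.Theorems.SawtoothPulseCascade.K1Cutoff
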